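import Mathlib.LinearAlgebra.Trace
import Mathlib.LinearAlgebra.Dual.Lemmas
import Literature.NumberTheory.Kottwitz1992.Involutions
import HarnessLib

/-!
# [Kottwitz1992, §2] Lemma 2.7 and the remark on the forms `(x, y)_b` — DISCHARGED:
# `Kottwitz1992_2_7_trace_eq_holds`, `Kottwitz1992_2_trForm_symm_alt_nondegenerate_holds`

Kernel-lane companion of the statement carpet ★ `Literature/NumberTheory/Kottwitz1992/Involutions.lean` (squad TK, TK-t01): the named
facts ★ `Involutions.Kottwitz1992_2_7_trace_eq` — «For all `b ∈ B` there are equalities `tr_{B/ℝ} b = tr_{B^opp/ℝ} b = tr_{B/ℝ} b*`» — and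
★ `Involutions.Kottwitz1992_2_trForm_symm_alt_nondegenerate` — «`(x, y)_b` is symmetric (respectively, alternating) if and only if `b` is
symmetric (respectively, antisymmetric, that is, `b* = −b`). … `(x, y)_b` is nondegenerate if and only if `b` is an invertible element of
`B`» — are PROVED here as `theorem Kottwitz1992_2_7_trace_eq_holds : Kottwitz1992_2_7_trace_eq B ι` and
`theorem Kottwitz1992_2_trForm_symm_alt_nondegenerate_holds : Kottwitz1992_2_trForm_symm_alt_nondegenerate B ι`.  THEOREMS ONLY (no
definition, no named fact, no `sorry`, no instance, no notation); cell hodgecm-mathlib, seat B-typ04 (g29); net debt −2.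

R. E. Kottwitz, *Points on some Shimura varieties over finite fields*, J. Amer. Math. Soc. 5 (1992), §2 p. 381 (held `paper:doi-10-2307-2152772`,
p0009 L21–L34).  THE PRINTED PROOF of Lemma 2.7: «Since `B` is semisimple, `tr_{B/ℝ}(xy)` is a nondegenerate bilinear form on `B`.  Right
multiplication by `b` and left multiplication by `b` are adjoint for this form.  Therefore `tr_{B/ℝ} b = tr_{B^opp/ℝ} b`.  Since `*` is an
isomorphism from `B^opp` to `B`, we have `tr_{B/ℝ} b* = tr_{B^opp/ℝ} b`.»; of the remark: «Using Lemma 2.7 we see that `(x, y)_b` is symmetric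
(respectively, alternating) if and only if … It is easy to see that `(x, y)_b` is nondegenerate if and only if `b` is an invertible element of `B`.»
Followed here step by step, in the tree's currency (`tr_{B/ℝ}` = ★ `Automorphic.leftMulTrace`, `(x, y)_b` = ★ `trForm ι b x y = tr_{B/ℝ}(x b y*)`,
the standing hypothesis ★ `IsAlgebraWithInvolution` = finite-dimensional + `IsSemisimpleRing` + ★ `IsInvolution`):
* §1 THE TRACE FORM `β(x, y) = tr_{B/ℝ}(xy)`: `tr(xy) = tr(yx)`; **nondegeneracy for semisimple `B`** — the radical `I = {y | tr(xy) = 0 ∀x}`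
  is a left ideal, a complement `J` (Mathlib: `IsSemisimpleModule B B` is a complemented lattice) writes `1 = e + f` with `z e = z` for `z ∈ I`,
  so `L_e` is an idempotent endomorphism of trace `tr(e) = 0`, hence `0` (Mathlib ★ `LinearMap.IsIdempotentElem.trace_eq_zero_iff`,
  characteristic `0`), `e = 0`, `I = I e = 0`; **`tr(L_b) = tr(R_b)`** — `θ : B → B^*`, `θ(y) = tr(· y)`, is injective hence bijective
  (`dim B^* = dim B`) and `θ ∘ L_b = ᵗ(R_b) ∘ θ` (adjointness), so `L_b` is conjugate to the transpose of `R_b` and `tr(L_b) = tr(ᵗR_b) = tr(R_b)`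
  (Mathlib ★ `LinearMap.trace_conj'`, ★ `LinearMap.trace_transpose'`); `tr_{B^opp}(b^op) = tr(R_b)` (transport along `op`) and
  `tr(L_{b*}) = tr(R_b)` (transport along the involution: `(b* x*)* = x b`).
* §2 Lemma 2.7 from §1.
* §3 the forms `(x, y)_b`: `(y, x)_b = (x, y)_{b*}` by Lemma 2.7 (`tr(y b x*) = tr((y b x*)*) = tr(x b* y*)`), so symmetry (resp. alternation,
  after polarisation) says `(x, y)_{b − b*} = 0` (resp. `(x, y)_{b + b*} = 0`) for all `x, y`, and an index `w` with `(x, y)_w ≡ 0` vanishes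
  (`x = 1`, `y = z*`, nondegeneracy); conversely `b* = b` gives symmetry and `b* = −b` gives `(x,x)_b = −(x,x)_b`.  Nondegeneracy in `x`:
  if `b ∈ B^×` and `(x, ·)_b = 0` then `tr((x b) z) = 0` for all `z`, so `x b = 0`, `x = 0`; if `b ∉ B^×` then right multiplication by `b` is
  not injective (finite dimension: injective ⇒ surjective ⇒ `c b = 1` ⇒ `b ∈ B^×`, a one-sided inverse being two-sided), and a non-zero `x`
  with `x b = 0` has `(x, ·)_b = 0`.
HONEST LABEL: HC_CM is proved only modulo the 7 printed citations (2 remaining: hLiu418, h413) until rung 0 closes; this file adds no citation debt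
(0 facts, 0 sorry) and discharges 2 named facts of ★ `Involutions`.

## References
* [Kottwitz1992] R. E. Kottwitz, Points on some Shimura varieties over finite fields, J. Amer. Math. Soc. 5 (1992) 373–444, §2 Lemma 2.7 and
  the Notation/remark following it, p. 381; §1 p. 378 (involutions); §2 p. 379 (the standing hypothesis).
-/

noncomputable section

namespace Literature.NumberTheory.Kottwitz1992.Involutions

open Literature.NumberTheory.Automorphic (leftMulTrace leftMulTrace_apply)

universe u

/-! ## §1 The trace form `tr_{B/ℝ}(xy)`: nondegeneracy for semisimple `B`, and `tr(L_b) = tr(R_b)` -/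

section TraceForm

variable {B : Type u} [Ring B] [Algebra ℝ B]

/-- `tr_{B/ℝ}(x y) = tr_{B/ℝ}(y x)` (`L_{xy} = L_x L_y` and `tr(fg) = tr(gf)`). [folklore] -/
private theorem leftMulTrace_mul_comm (x y : B) : leftMulTrace ℝ B (x * y) = leftMulTrace ℝ B (y * x) := by
  rw [leftMulTrace_apply, leftMulTrace_apply, map_mul (Algebra.lmul ℝ B), map_mul (Algebra.lmul ℝ B), LinearMap.trace_mul_comm]

/-- **Nondegeneracy of the trace form** `β(x, y) = tr_{B/ℝ}(xy)` on a finite-dimensional SEMISIMPLE `ℝ`-algebra: the radical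
`I = {y | tr(xy) = 0 ∀x}` is a left ideal; a complement `J` (semisimplicity) writes `1 = e + f` with `e ∈ I` idempotent and `I = Ie`;
`L_e` is an idempotent endomorphism of trace `tr(e) = 0`, hence `0` (characteristic zero), so `e = 0` and `I = 0`.
[cite: Kottwitz1992, §2 Lemma 2.7 (p. 381)] -/
private theorem eq_zero_of_forall_leftMulTrace_mul_eq_zero [FiniteDimensional ℝ B] [IsSemisimpleRing B] {y : B}
    (hy : ∀ x : B, leftMulTrace ℝ B (x * y) = 0) : y = 0 := by
  -- the radical as a left ideal
  let I : Submodule B B :=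
    { carrier := {z | ∀ x : B, leftMulTrace ℝ B (x * z) = 0}
      add_mem' := fun {a b} ha hb x => by rw [mul_add, map_add, ha x, hb x, add_zero]
      zero_mem' := fun x => by rw [mul_zero, map_zero]
      smul_mem' := fun c {z} hz x => by
        show leftMulTrace ℝ B (x * (c * z)) = 0
        rw [← mul_assoc]; exact hz (x * c) }
  have hyI : y ∈ I := hy
  obtain ⟨J, hIJ⟩ := exists_isCompl I
  obtain ⟨e, he, f, hf, hef⟩ := Submodule.mem_sup.mp (show (1 : B) ∈ I ⊔ J by rw [hIJ.sup_eq_top]; exact Submodule.mem_top)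
  -- for `z ∈ I`: `z = z e`
  have hze : ∀ z ∈ I, z * e = z := by
    intro z hz
    have h1 : z * e + z * f = z := by rw [← mul_add, hef, mul_one]
    have hzf : z * f ∈ I ⊓ J := by
      refine ⟨?_, J.smul_mem z hf⟩
      have : z * f = z - z * e := by rw [eq_sub_iff_add_eq']; exact h1
      rw [this]
      exact I.sub_mem hz (I.smul_mem z he)
    rw [hIJ.inf_eq_bot, Submodule.mem_bot] at hzf
    rw [hzf, add_zero] at h1
    exact h1
  -- `L_e` is an idempotent of trace zero, hence zero
  have hee : e * e = e := hze e he
  have hidem : IsIdempotentElem (Algebra.lmul ℝ B e) := by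
    rw [IsIdempotentElem, ← map_mul, hee]
  have htr : LinearMap.trace ℝ B (Algebra.lmul ℝ B e) = 0 := by
    have := he 1
    rwa [one_mul, leftMulTrace_apply] at this
  have hLe : Algebra.lmul ℝ B e = 0 := (LinearMap.IsIdempotentElem.trace_eq_zero_iff hidem).mp htr
  have he0 : e = 0 := by
    have := congrArg (fun T : Module.End ℝ B => T 1) hLe
    simpa using this
  have := hze y hyI
  rw [he0, mul_zero] at this
  exact this.symm

/-- **`tr_{B/ℝ}(L_b) = tr_{B/ℝ}(R_b)`** for a finite-dimensional semisimple `ℝ`-algebra: `θ : B → B^*`, `θ(y) = tr(· y)`, is injective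
(nondegeneracy), hence bijective, and `θ ∘ L_b = ᵗ(R_b) ∘ θ`; so `L_b` and the transpose of `R_b` are conjugate and
`tr(L_b) = tr(ᵗR_b) = tr(R_b)`. [cite: Kottwitz1992, §2 Lemma 2.7 (p. 381)] -/
private theorem trace_mulLeft_eq_trace_mulRight [FiniteDimensional ℝ B] [IsSemisimpleRing B] (b : B) :
    LinearMap.trace ℝ B (LinearMap.mulLeft ℝ b) = LinearMap.trace ℝ B (LinearMap.mulRight ℝ b) := by
  -- `θ y = (x ↦ tr(x y))`
  let θ : B →ₗ[ℝ] Module.Dual ℝ B :=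
    { toFun := fun y => (leftMulTrace ℝ B) ∘ₗ (LinearMap.mulRight ℝ y)
      map_add' := fun y z => by ext x; simp [mul_add]
      map_smul' := fun r y => by ext x; simp }
  have hθ : ∀ x y : B, θ y x = leftMulTrace ℝ B (x * y) := fun x y => rfl
  have hinj : Function.Injective θ := by
    rw [← LinearMap.ker_eq_bot, LinearMap.ker_eq_bot']
    intro y hy0
    refine eq_zero_of_forall_leftMulTrace_mul_eq_zero fun x => ?_
    rw [← hθ, hy0, LinearMap.zero_apply]
  let Θ : B ≃ₗ[ℝ] Module.Dual ℝ B :=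
    LinearMap.linearEquivOfInjective θ hinj (Subspace.dual_finrank_eq).symm
  have hΘ : ∀ y, Θ y = θ y := fun y => rfl
  -- intertwining: `Θ (b y) = ᵗ(R_b) (Θ y)`
  have hconj : Module.Dual.transpose (R := ℝ) (LinearMap.mulRight ℝ b) = Θ.conj (LinearMap.mulLeft ℝ b) := by
    apply LinearMap.ext
    intro φ
    obtain ⟨y, rfl⟩ := Θ.surjective φ
    rw [LinearEquiv.conj_apply_apply, LinearEquiv.symm_apply_apply, Module.Dual.transpose_apply, LinearMap.mulLeft_apply, hΘ, hΘ]
    ext x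
    rw [LinearMap.comp_apply, LinearMap.mulRight_apply, hθ, hθ, mul_assoc]
  rw [← LinearMap.trace_conj' (LinearMap.mulLeft ℝ b) Θ, ← hconj, LinearMap.trace_transpose']

/-- `tr_{B^opp/ℝ}(b^op) = tr_{B/ℝ}(R_b)`: left multiplication by `b^op` on `B^opp` is right multiplication by `b` transported along `op`. [folklore] -/
private theorem leftMulTrace_op_eq_trace_mulRight (b : B) :
    leftMulTrace ℝ Bᵐᵒᵖ (MulOpposite.op b) = LinearMap.trace ℝ B (LinearMap.mulRight ℝ b) := by
  rw [leftMulTrace_apply]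
  have h : (Algebra.lmul ℝ Bᵐᵒᵖ (MulOpposite.op b) : Bᵐᵒᵖ →ₗ[ℝ] Bᵐᵒᵖ) =
      (MulOpposite.opLinearEquiv ℝ (M := B)).conj (LinearMap.mulRight ℝ b) := by
    apply LinearMap.ext
    intro z
    induction z using MulOpposite.rec' with
    | h u =>
      rw [LinearEquiv.conj_apply_apply]
      simp
  rw [h, LinearMap.trace_conj']

/-- `tr_{B/ℝ}(L_{b*}) = tr_{B/ℝ}(R_b)`: the involution conjugates `L_{b*}` to `R_b` (`(b* x*)* = x b`). [cite: Kottwitz1992, §2 Lemma 2.7 (p. 381)] -/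
private theorem leftMulTrace_invol_eq_trace_mulRight {ι : B →ₗ[ℝ] B} (hι : IsInvolution ℝ B ι) (b : B) :
    leftMulTrace ℝ B (ι b) = LinearMap.trace ℝ B (LinearMap.mulRight ℝ b) := by
  rw [leftMulTrace_apply]
  let E : B ≃ₗ[ℝ] B := LinearEquiv.ofInvolutive ι hι.apply_apply
  have hE : ∀ x, E x = ι x := fun x => rfl
  have hEs : ∀ x, E.symm x = ι x := by
    intro x
    apply E.injective
    rw [LinearEquiv.apply_symm_apply, hE, hι.apply_apply]
  have h : (Algebra.lmul ℝ B (ι b) : B →ₗ[ℝ] B) = E.conj (LinearMap.mulRight ℝ b) := by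
    apply LinearMap.ext
    intro z
    rw [LinearEquiv.conj_apply_apply, hEs, hE, LinearMap.mulRight_apply, hι.map_mul, hι.apply_apply]
    simp
  rw [h, LinearMap.trace_conj']

/-- `tr_{B/ℝ}(b)` is the trace of `L_b = mulLeft b`. [folklore] -/
private theorem leftMulTrace_eq_trace_mulLeft (b : B) : leftMulTrace ℝ B b = LinearMap.trace ℝ B (LinearMap.mulLeft ℝ b) := by
  rw [leftMulTrace_apply]
  congr 1

end TraceForm

/-! ## §2 Lemma 2.7 -/

section LemmaTwoSeven

variable (B : Type u) [Ring B] [Algebra ℝ B] (ι : B →ₗ[ℝ] B)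

/-- **Lemma 2.7, PROVED**: ★ `Kottwitz1992_2_7_trace_eq` holds — «For all `b ∈ B` there are equalities `tr_{B/ℝ} b = tr_{B^opp/ℝ} b = tr_{B/ℝ} b*`»
for a finite-dimensional semisimple `ℝ`-algebra with involution: `tr(L_b) = tr(R_b)` by the nondegeneracy of the trace form (this is where
semisimplicity enters), `tr_{B^opp}(b^op) = tr(R_b)` (transport along `op`) and `tr(L_{b*}) = tr(R_b)` (transport along `*`).
[cite: Kottwitz1992, Lemma 2.7 (p. 381)] -/
theorem Kottwitz1992_2_7_trace_eq_holds : Kottwitz1992_2_7_trace_eq B ι := by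
  intro hB b
  haveI : FiniteDimensional ℝ B := hB.finiteDimensional
  haveI : IsSemisimpleRing B := hB.isSemisimpleRing
  have h1 : leftMulTrace ℝ B b = LinearMap.trace ℝ B (LinearMap.mulRight ℝ b) := by
    rw [leftMulTrace_eq_trace_mulLeft, trace_mulLeft_eq_trace_mulRight]
  exact ⟨h1.trans (leftMulTrace_op_eq_trace_mulRight b).symm, h1.trans (leftMulTrace_invol_eq_trace_mulRight hB.isInvolution b).symm⟩

end LemmaTwoSeven

/-! ## §3 The trace forms `(x, y)_b = tr_{B/ℝ}(x b y*)`: symmetric, alternating, nondegenerate -/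

section TrForm

variable (B : Type u) [Ring B] [Algebra ℝ B] (ι : B →ₗ[ℝ] B)

variable {B ι} in
/-- `(y, x)_b = (x, y)_{b*}`: `tr(y b x*) = tr((y b x*)*) = tr(x b* y*)` (Lemma 2.7: `tr z* = tr z`). [cite: Kottwitz1992, §2 (p. 381)] -/
private theorem trForm_swap [FiniteDimensional ℝ B] [IsSemisimpleRing B] (hι : IsInvolution ℝ B ι) (b x y : B) :
    trForm ι b y x = trForm ι (ι b) x y := by
  unfold trForm
  rw [(Kottwitz1992_2_7_trace_eq_holds B ι ⟨‹_›, ‹_›, hι⟩ (y * b * ι x)).2, hι.map_mul, hι.map_mul, hι.apply_apply, mul_assoc]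

variable {B ι} in
/-- `(x, y)_b − (x, y)_{b′} = tr(x (b − b′) y*)` bookkeeping: the form is additive in `b`. [folklore] -/
private theorem trForm_sub_index (b b' x y : B) : trForm ι b x y - trForm ι b' x y = trForm ι (b - b') x y := by
  unfold trForm
  rw [← map_sub, mul_sub, sub_mul]

variable {B ι} in
/-- An element `w` with `tr(w z) = 0` for all `z` vanishes (nondegeneracy, semisimple case). [cite: Kottwitz1992, §2 (p. 381)] -/
private theorem eq_zero_of_forall_leftMulTrace_mul_eq_zero' [FiniteDimensional ℝ B] [IsSemisimpleRing B] {w : B}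
    (hw : ∀ z : B, leftMulTrace ℝ B (w * z) = 0) : w = 0 :=
  eq_zero_of_forall_leftMulTrace_mul_eq_zero fun z => by rw [leftMulTrace_mul_comm]; exact hw z

variable {B ι} in
/-- If `(x, y)_w = 0` for all `x, y` then `w = 0` (take `x = 1`, `y = z*`). [cite: Kottwitz1992, §2 (p. 381)] -/
private theorem index_eq_zero_of_forall [FiniteDimensional ℝ B] [IsSemisimpleRing B] (hι : IsInvolution ℝ B ι) {w : B}
    (hw : ∀ x y : B, trForm ι w x y = 0) : w = 0 := by
  refine eq_zero_of_forall_leftMulTrace_mul_eq_zero' fun z => ?_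
  have := hw 1 (ι z)
  rwa [trForm, one_mul, hι.apply_apply] at this

variable {B} in
/-- In a finite-dimensional algebra a one-sided inverse is two-sided: `c b = 1 ⇒ b ∈ B^×`. [folklore] -/
private theorem isUnit_of_mul_eq_one_left [FiniteDimensional ℝ B] {b c : B} (h : c * b = 1) : IsUnit b := by
  have hinj : Function.Injective (LinearMap.mulLeft ℝ b) := by
    intro x y hxy
    have := congrArg (fun t => c * t) hxy
    simpa only [LinearMap.mulLeft_apply, ← mul_assoc, h, one_mul] using this
  obtain ⟨d, hd⟩ := (LinearMap.injective_iff_surjective.mp hinj) 1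
  rw [LinearMap.mulLeft_apply] at hd
  have hcd : c = d := by
    calc c = c * (b * d) := by rw [hd, mul_one]
      _ = d := by rw [← mul_assoc, h, one_mul]
  rw [hcd] at h
  exact ⟨⟨b, d, hd, h⟩, rfl⟩

/-- **The trace forms `(x, y)_b`, PROVED**: ★ `Kottwitz1992_2_trForm_symm_alt_nondegenerate` holds — «`(x, y)_b` is symmetric (respectively,
alternating) if and only if `b` is symmetric (respectively, antisymmetric) … `(x, y)_b` is nondegenerate if and only if `b` is an invertible
element of `B`»: by Lemma 2.7, `(y, x)_b = (x, y)_{b*}`, so symmetry/alternation put `b ∓ b*` in the radical of the (nondegenerate) trace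
form; nondegeneracy in `x` is `x b = 0 ⇒ x = 0`, i.e. (finite dimension) `b ∈ B^×`. [cite: Kottwitz1992, §2 (p. 381)] -/
theorem Kottwitz1992_2_trForm_symm_alt_nondegenerate_holds : Kottwitz1992_2_trForm_symm_alt_nondegenerate B ι := by
  intro hB b
  haveI : FiniteDimensional ℝ B := hB.finiteDimensional
  haveI : IsSemisimpleRing B := hB.isSemisimpleRing
  have hι : IsInvolution ℝ B ι := hB.isInvolution
  refine ⟨⟨fun h => ?_, fun h x y => ?_⟩, ⟨fun h => ?_, fun h x => ?_⟩, ⟨fun h => ?_, fun h x hx => ?_⟩⟩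
  · -- symmetric ⇒ `b* = b`
    have hw : b - ι b = 0 := index_eq_zero_of_forall hι fun x y => by
      rw [← trForm_sub_index, ← trForm_swap hι, h x y, sub_self]
    exact (sub_eq_zero.mp hw).symm
  · -- `b* = b` ⇒ symmetric
    rw [trForm_swap hι b y x, h]
  · -- alternating ⇒ `b* = −b`
    have hw : b + ι b = 0 := index_eq_zero_of_forall hι fun x y => by
      have hpol := h (x + y)
      unfold trForm at hpol h ⊢
      rw [map_add, add_mul, add_mul, mul_add, mul_add, map_add, map_add, map_add, h x, h y, zero_add, add_zero] at hpol
      -- `hpol : tr(x b y*) + tr(y b x*) = 0`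
      have hs : leftMulTrace ℝ B (y * b * ι x) = leftMulTrace ℝ B (x * ι b * ι y) := trForm_swap hι b x y
      rw [hs, ← map_add, ← add_mul, ← mul_add] at hpol
      exact hpol
    exact eq_neg_of_add_eq_zero_right hw
  · -- `b* = −b` ⇒ alternating
    have hs := trForm_swap hι b x x
    rw [h] at hs
    unfold trForm at hs ⊢
    rw [mul_neg, neg_mul, map_neg] at hs
    linarith
  · -- nondegenerate ⇒ `b ∈ B^×`
    by_contra hb
    have hninj : ¬ Function.Injective (LinearMap.mulRight ℝ b) := by
      intro hinj
      obtain ⟨c, hc⟩ := (LinearMap.injective_iff_surjective.mp hinj) 1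
      rw [LinearMap.mulRight_apply] at hc
      exact hb (isUnit_of_mul_eq_one_left hc)
    obtain ⟨x, hx0, hxb⟩ : ∃ x : B, x ≠ 0 ∧ x * b = 0 := by
      by_contra hall
      push Not at hall
      apply hninj
      rw [← LinearMap.ker_eq_bot, LinearMap.ker_eq_bot']
      intro x hx
      rw [LinearMap.mulRight_apply] at hx
      by_contra hx0
      exact hall x hx0 hx
    refine hx0 (h x fun y => ?_)
    rw [trForm, hxb, zero_mul, map_zero]
  · -- `b ∈ B^×` ⇒ nondegenerate
    obtain ⟨u, rfl⟩ := h
    have hxb : x * (u : B) = 0 := by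
      refine eq_zero_of_forall_leftMulTrace_mul_eq_zero' fun z => ?_
      have := hx (ι z)
      rwa [trForm, hι.apply_apply] at this
    simpa using congrArg (fun t => t * ((u⁻¹ : Bˣ) : B)) hxb

end TrForm

end Literature.NumberTheory.Kottwitz1992.Involutions

end
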